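import Literature.Computability.Complexity.WorstCaseToMildFunction
import Literature.Computability.Complexity.IWAmpFunction
import Literature.Computability.MetaComplexity.NWPolynomialRegime
import Literature.Computability.Complexity.PRGDerandomization
import Literature.Computability.AlgebraicComplexity.RazMonomialCircuits
import HarnessLib

/-!
# The pseudorandom generator armed with a hard truth table (IKW 2002, Thm. 11 = [BFNW93, KM99]):
# the explicit generator and its pseudorandomness

Literature / circuit complexity — derandomization. The MATHEMATICAL half of the discrete Theorem 11 of
Impagliazzo–Kabanets–Wigderson recorded in `HardnessVsRandomness.lean` (and consumed, in the polynomial-seed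
form `c·m^{sx}`, by `IKW2002_thm12_2_of_thm11`, `IKWGeneratorsProofs.lean`): for a Boolean function
`f : {0,1}^m → {0,1}` and an output length `n`, an explicit generator `IKWGen.gen f n` on
`IKWGen.seedLen m n = q₂²` seed bits — the Nisan–Wigderson generator over the polynomial design
(`NWPolynomialRegime.lean`) of the Impagliazzo–Wigderson / Healy–Vadhan–Viola amplification
(`IWAmpFunction.lean`, blocks again a polynomial design, the Hankel hitter indexed by the bits of the block
number) of the low-degree-extension bits of the zero-padded `f` (`WorstCaseToMildFunction.lean`) — with
ALL parameters explicit functions of `(m, n)`, and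

* **`IKWGen.isSizePseudorandom_gen`** — for `n ≥ 1`, if `circuitSizeOver B2 f > IKWGen.sizeBound m n` then
  `gen f n` is `SIZE(n)`-pseudorandom (the three links composed: a size-`n` distinguisher gives, by the NW
  reconstruction, a circuit agreeing with the amplified function on `1/2 + 1/S₂`, `S₂ = n(n·univBound ℓ + n + 2)`;
  decoding the amplification gives a circuit with fewer than `2^{N₁}/N₁⁶` errors on the mildly hard
  function; self-correction then computes `f` within `sizeBound m n`).

* the parameters (`IKWGen.eta`, `N1`, `ell`, `S2`, `kk`, `CC`, `mH`, `q1`, `blocks`, `hidx`, `L2`, `q2`) are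
  explicit functions of `(m, n)`, all polynomial in `T = n + m + 2` (section `Bounds`: `kk_le`, `CC_le`,
  `predSize_le`, `sBig_le`, **`sizeBound_le`**: `sizeBound m n ≤ Z · T⁶⁶` with a symbolic constant `Z`), and the
  seed is `O(m⁴)` in the non-vacuous regime `T < 2^{m+3}` (section `Seed`: `mH_le`, `L2_le`,
  **`seedLen_le_mul_pow`**: `seedLen m n ≤ cSeed · m⁴`) — two stacked quadratic algebraic designs, whence
  the exponent `4` (the recorded target has `2`, reachable only with a linear-length amplification);
* `IKWGen.genPad f n K` — the generator on `K` seed bits (the first `q₂²` are used), `isSizePseudorandom_genPad`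
  (extra seed bits are harmless), `isSizePseudorandom_zero` (`n = 0` is vacuous), and the MAIN THEOREM
  **`IKWGen.exists_hardness_exponent`**: *there is `c₀ ≥ 1` such that for all `m, n` and every
  `f : {0,1}^m → {0,1}` with `(n + m)^{c₀} < circuitSizeOver B2 f`, `genPad f n (c₀ · m⁴)` is
  `SIZE(n)`-pseudorandom* — the combinatorial half of the discrete Theorem 11 with seed `c · m⁴`; the `FP`
  machine computing `genPad` from the table (so that `tableGenerator F f (c₀ m⁴) n = genPad f n (c₀ m⁴)`) is the
  remaining, separate obligation.

Everything is proved. Nothing duplicates the tree (searched `IKWGen`, `tableGen`, `sizeBound`).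

## References

* R. Impagliazzo, V. Kabanets, A. Wigderson, *In search of an easy witness*, JCSS 65 (2002), Thm. 11
  [ImpagliazzoKabanetsWigderson2002].
* L. Babai, L. Fortnow, N. Nisan, A. Wigderson, *BPP has subexponential time simulations unless EXPTIME
  has publishable proofs*, Comput. Complexity 3 (1993) 307–318, §3–4.
* N. Nisan, A. Wigderson, *Hardness vs randomness*, JCSS 49 (1994), Lemmas 2.4–2.5 [NisanWigderson1994].
* R. Impagliazzo, A. Wigderson, STOC 1997, Thm. 1 [ImpagliazzoWigderson1997]; S. Hirahara, ECCC TR22-119,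
  Lemma 8.1 [Hirahara2022PartialMCSP].
* S. Arora, B. Barak, *Computational Complexity: A Modern Approach*, CUP 2009, Thm. 19.21, Lemma 20.15
  [AroraBarakCC2009].
-/

noncomputable section

namespace Literature.Computability.Complexity

open Finset MetaComplexity SelfCorrect MildHard MildHardFn IWAmpBridge IWAmpFn

namespace IKWGen

/-! ### The parameters, as explicit functions of `(m, n)` -/

/-- Some scale fits: `η ≥ 2` with `m ≤ nOf η`. [folklore] -/
theorem exists_scale (m : ℕ) : ∃ η : ℕ, 2 ≤ η ∧ m ≤ nOf η := by
  refine ⟨m + 2, by omega, ?_⟩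
  unfold nOf kOf
  calc m ≤ m + 2 := by omega
    _ ≤ 2 ^ (m + 2) * (m + 2) := Nat.le_mul_of_pos_left _ Nat.one_le_two_pow

open Classical in
/-- **The scale** `η(m)`: the least `η ≥ 2` with `m ≤ η 2^η` variables in the padding. [cite: AroraBarakCC2009, Thm. 19.21 (proof: padding)] -/
def eta (m : ℕ) : ℕ := Nat.find (exists_scale m)

open Classical in
/-- `η(m) ≥ 2` and `m ≤ nOf (η m)`. [folklore] -/
theorem eta_spec (m : ℕ) : 2 ≤ eta m ∧ m ≤ nOf (eta m) := Nat.find_spec (exists_scale m)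

/-- The input length of the mildly hard function: `N₁ = lenOf (η m)`. [folklore] -/
def N1 (m : ℕ) : ℕ := lenOf (eta m)

/-- `1 ≤ N₁`. [folklore] -/
theorem one_le_N1 (m : ℕ) : 1 ≤ N1 m := by unfold N1 lenOf; omega

/-- The intersection parameter of the output design: `ℓ = ⌊log₂ n⌋ + 1` (so `n < 2^ℓ`). [folklore] -/
def ell (n : ℕ) : ℕ := Nat.log 2 n + 1

/-- `n ≤ 2^ℓ`. [folklore] -/
theorem le_two_pow_ell (n : ℕ) : n ≤ 2 ^ ell n := (Nat.lt_pow_succ_log_self one_lt_two n).le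

/-- The average-case hardness asked of the amplified function: `S₂ = n (n · univBound ℓ + n + 2)` (the
threshold of `fools_nwGenerator_cikkDesign`). [cite: AroraBarakCC2009, Lemma 20.15] -/
def S2 (n : ℕ) : ℕ := n * (n * univBound (ell n) + n + 2)

/-- The number of blocks of the amplification: `k = 6 S₂ N₁⁶` (`k ε δ ≥ 6` with `ε = 1/S₂`, `δ = N₁⁻⁶`).
[cite: Hirahara2022PartialMCSP, Lemma 8.1] -/
def kk (m n : ℕ) : ℕ := 6 * S2 n * N1 m ^ 6

/-- The decoding parameter `C = 2 k S₂ N₁⁶` (`C ε δ ≥ 2k`). [cite: Hirahara2022PartialMCSP, Lemma 8.1] -/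
def CC (m n : ℕ) : ℕ := 2 * kk m n * S2 n * N1 m ^ 6

/-- The Hankel index length and the intersection parameter of the blocks: `⌊log₂ k⌋ + 1`. [folklore] -/
def mH (m n : ℕ) : ℕ := Nat.log 2 (kk m n) + 1

/-- `k ≤ 2^{mH}`. [folklore] -/
theorem kk_le_two_pow_mH (m n : ℕ) : kk m n ≤ 2 ^ mH m n := (Nat.lt_pow_succ_log_self one_lt_two _).le

/-- The prime of the block design: `q₁ = leastPrimeGe N₁`. [folklore] -/
def q1 (m : ℕ) : ℕ := leastPrimeGe (N1 m)

/-- `N₁ ≤ q₁`, `q₁` prime, `q₁ ≤ 2 N₁`. [folklore] -/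
theorem q1_spec (m : ℕ) : N1 m ≤ q1 m ∧ (q1 m).Prime ∧ q1 m ≤ 2 * N1 m :=
  ⟨(leastPrimeGe_spec _).1, (leastPrimeGe_spec _).2, leastPrimeGe_le _ (by have := one_le_N1 m; omega)⟩

/-- `q₁` is prime (instance for `ZMod (q1 m)`). [folklore] -/
instance q1_prime (m : ℕ) : Fact (q1 m).Prime := ⟨(q1_spec m).2.1⟩

/-- **The blocks of the amplification**: `k` blocks of size `N₁` in the universe `Fin (q₁·q₁)`, block `i` the
graph of the `𝔽_{q₁}`-polynomial with coefficient string "the bits of `i`" (degree `≤ mH`), pairwise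
intersections `≤ mH`. [cite: NisanWigderson1994, Lemma 2.5] -/
def blocks (m n : ℕ) : Fin (kk m n) → (Fin (N1 m) ↪ Fin (q1 m * q1 m)) :=
  fun i => cikkDesign (q1 m) (N1 m) (mH m n) (q1_spec m).1 fun c : Fin (mH m n) => (i : ℕ).testBit c

/-- The blocks form a design with intersections `≤ mH`. [folklore] -/
theorem isNWDesign_blocks (m n : ℕ) : IsNWDesign (mH m n) (blocks m n) :=
  isNWDesign_cikkDesign_testBit (q1 m) (N1 m) (mH m n) (kk m n) (q1_spec m).1 (kk_le_two_pow_mH m n)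

/-- **The Hankel indexing**: the bits of the block number in `𝔽₂`. [folklore] -/
def hidx (m n : ℕ) : Fin (kk m n) → Fin (mH m n) → ZMod 2 := fun i c => if (i : ℕ).testBit c then 1 else 0

/-- The indexing is injective. [folklore] -/
theorem hidx_injective (m n : ℕ) : Function.Injective (hidx m n) := by
  intro i j h
  apply testBit_injective_of_lt (kk_le_two_pow_mH m n)
  funext c
  have hc := congrFun h c
  simp only [hidx] at hc
  -- `0 ≠ 1` in `𝔽₂`
  by_cases hi : (i : ℕ).testBit c <;> by_cases hj : (j : ℕ).testBit c <;> simp_all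

/-- The input length of the amplified function: `L₂ = q₁² + ((N₁ + mH) + N₁)` (the `x`-part, then the Hankel
seed). [folklore] -/
def L2 (m n : ℕ) : ℕ := q1 m * q1 m + ((N1 m + mH m n) + N1 m)

/-- The prime of the output design: `q₂ = leastPrimeGe L₂`. [folklore] -/
def q2 (m n : ℕ) : ℕ := leastPrimeGe (L2 m n)

/-- `L₂ ≤ q₂`, `q₂` prime, `q₂ ≤ 2 L₂`. [folklore] -/
theorem q2_spec (m n : ℕ) : L2 m n ≤ q2 m n ∧ (q2 m n).Prime ∧ q2 m n ≤ 2 * L2 m n := by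
  have hL : 1 ≤ L2 m n := by unfold L2; have := one_le_N1 m; omega
  exact ⟨(leastPrimeGe_spec _).1, (leastPrimeGe_spec _).2, leastPrimeGe_le _ (by omega)⟩

/-- `q₂` is prime (instance for `ZMod (q2 m n)`). [folklore] -/
instance q2_prime (m n : ℕ) : Fact (q2 m n).Prime := ⟨(q2_spec m n).2.1⟩

/-- **The seed length** `q₂²`. [cite: ImpagliazzoKabanetsWigderson2002, Thm. 11] -/
def seedLen (m n : ℕ) : ℕ := q2 m n * q2 m n

/-! ### The three functions -/

variable {m : ℕ} (f : (Fin m → Bool) → Bool) (n : ℕ)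

/-- **The mildly hard function** `g₁` of `f` (low-degree-extension bits of the zero-padding of `f` at scale
`η m`). [cite: AroraBarakCC2009, Thm. 19.21] -/
def g1 : (Fin (N1 m) → Bool) → Bool := mildFn f (eta m) (eta_spec m).2

/-- **The strongly hard function** `g₂ = Amp^{g₁}` on `L₂` bits. [cite: ImpagliazzoWigderson1997, Thm. 1] -/
def g2 : (Fin (L2 m n) → Bool) → Bool := ampFn (blocks m n) (hidx m n) (g1 f)

/-- **The generator** `G_f : {0,1}^{q₂²} → {0,1}ⁿ`: the NW generator of `g₂` over the polynomial design with
`n` blocks of size `L₂` and intersections `≤ ℓ`. [cite: ImpagliazzoKabanetsWigderson2002, Thm. 11]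
[cite: NisanWigderson1994, Lemma 2.4] -/
def gen (s : Fin (seedLen m n) → Bool) : Fin n → Bool :=
  nwGenerator (fun i : Fin n => cikkDesign (q2 m n) (L2 m n) (ell n) (q2_spec m n).1
    fun c : Fin (ell n) => (i : ℕ).testBit c) (g2 f n) s

/-! ### The size bound and the pseudorandomness -/

/-- The size against which the mild function must be hard: the decoder of the amplification on a size-`S₂`
received word, `(2C² + 1) · predSize q₁² k S₂ mH + 9C² + 3`. [cite: Hirahara2022PartialMCSP, Lemma 8.1] -/
def sBig (m n : ℕ) : ℕ :=
  (2 * CC m n ^ 2 + 1) * predSize (q1 m * q1 m) (kk m n) (S2 n) (mH m n) + (9 * CC m n ^ 2 + 3)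

/-- **The size bound** of the whole reduction: `432 · A(η m)⁶ (sBig + 11) + 2`. [cite: AroraBarakCC2009, Thm. 19.21] -/
def sizeBound (m n : ℕ) : ℕ := 432 * AOf (eta m) ^ 6 * (sBig m n + 11) + 2

/-- **Step 1**: the mild hardness of `g₁` against the decoder size. [cite: AroraBarakCC2009, Thm. 19.21] -/
theorem mild_g1 (hsize : sizeBound m n < circuitSizeOver B2 f) (K : Circuit (Fin (N1 m))) (hB : K.IsOver B2)
    (hs : K.size ≤ sBig m n) :
    (1 / ((N1 m : ℝ)) ^ 6) * 2 ^ N1 m ≤ ((Finset.univ.filter fun v => K.eval v ≠ g1 f v).card : ℝ) := by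
  have hN : (0 : ℝ) < N1 m := by exact_mod_cast one_le_N1 m
  have hK : 432 * AOf (eta m) ^ 6 * (K.size + 11) + 2 < circuitSizeOver B2 f :=
    lt_of_le_of_lt (by unfold sizeBound; gcongr) hsize
  have h := MildHardFn.mild_of_worst f (eta m) (eta_spec m).2 (eta_spec m).1 K hB hK
  unfold g1 N1 at *
  rw [one_div, ← div_eq_inv_mul, div_le_iff₀ (by positivity)]
  linarith

/-- **Step 2**: the strong average-case hardness of `g₂`: `H_avg(g₂) ≥ S₂` (for `n ≥ 1`).
[cite: ImpagliazzoWigderson1997, Thm. 1] -/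
theorem avgHard_g2 (hn : 0 < n) (hsize : sizeBound m n < circuitSizeOver B2 f) :
    AvgHardAtLeast (g2 f n) (S2 n) := by
  have hN : (0 : ℝ) < N1 m := by exact_mod_cast one_le_N1 m
  have hS : 0 < S2 n := by unfold S2; positivity
  refine avgHardAtLeast_ampFn (blocks m n) (hidx m n) (g1 f) (hidx_injective m n) (δ := 1 / (N1 m : ℝ) ^ 6)
    (by positivity) hS ?_ (C := CC m n) ?_ (maxT := mH m n)
    (fun i j => IWAmp.card_Tsub_le (fun i j hij => isNWDesign_blocks m n hij) i j) ?_
  · -- `6 S₂ ≤ k / N₁⁶`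
    rw [show (kk m n : ℝ) = 6 * S2 n * (N1 m : ℝ) ^ 6 by unfold kk; push_cast; ring]
    field_simp
    rfl
  · -- `2 k S₂ ≤ C / N₁⁶`
    rw [show (CC m n : ℝ) = 2 * kk m n * S2 n * (N1 m : ℝ) ^ 6 by unfold CC; push_cast; ring]
    field_simp
    rfl
  · intro K hB hs
    exact mild_g1 f n hsize K hB hs

/-- **Step 3: the generator is `SIZE(n)`-pseudorandom** (for `n ≥ 1`) as soon as `f` is harder than the size
bound. [cite: ImpagliazzoKabanetsWigderson2002, Thm. 11] [cite: NisanWigderson1994, Lemma 2.4] -/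
theorem isSizePseudorandom_gen (hn : 0 < n) (hsize : sizeBound m n < circuitSizeOver B2 f) :
    IsSizePseudorandom (gen f n) := by
  have h := isSizePseudorandom_nwGenerator_cikkDesign (q2_spec m n).1 hn (le_two_pow_ell n) (g2 f n)
    (S := (S2 n : ℝ)) (avgHard_g2 f n hn hsize) (by unfold S2; exact_mod_cast le_rfl) (Equiv.refl (Fin (seedLen m n)))
  exact h

/-! ### Polynomial bounds on the parameters

Everything is bounded by a constant times a power of `T = n + m + 2`; the constants are kept symbolic
(`κ`, `γ`, `Z`) and finally absorbed into the exponent (`Z ≤ T^Z`); `univBound d ≤ 5 · 2^d` is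
`Literature.Computability.AlgebraicComplexity.RazMonomialCkt.univBound_le` (`AlgebraicComplexity/RazMonomialCircuits.lean`). -/

section Bounds

open Classical in
/-- Minimality of the scale: smaller scales `≥ 2` do not fit. [folklore] -/
theorem nOf_lt_of_lt_eta {m η' : ℕ} (h2 : 2 ≤ η') (hlt : η' < eta m) : nOf η' < m := by
  have := Nat.find_min (exists_scale m) hlt
  rw [not_and, not_le] at this
  exact this h2

/-- `2^η · η ≤ 4m + 8` at the scale `η = eta m`. [folklore] -/
theorem two_pow_eta_mul_le (m : ℕ) : 2 ^ eta m * eta m ≤ 4 * m + 8 := by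
  obtain ⟨h2, -⟩ := eta_spec m
  rcases h2.eq_or_lt with h | hgt
  · rw [← h]; norm_num
  · have hmin := nOf_lt_of_lt_eta (m := m) (η' := eta m - 1) (by omega) (by omega)
    unfold nOf kOf at hmin
    have e : 2 ^ eta m = 2 * 2 ^ (eta m - 1) := by rw [← pow_succ']; congr 1; omega
    rw [e]
    have h3 : eta m ≤ 2 * (eta m - 1) := by omega
    calc 2 * 2 ^ (eta m - 1) * eta m ≤ 2 * 2 ^ (eta m - 1) * (2 * (eta m - 1)) := Nat.mul_le_mul_left _ h3
      _ = 4 * (2 ^ (eta m - 1) * (eta m - 1)) := by ring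
      _ ≤ 4 * m + 8 := by omega

/-- `2^η ≤ 2m + 4` at the scale `η = eta m`. [folklore] -/
theorem two_pow_eta_le (m : ℕ) : 2 ^ eta m ≤ 2 * m + 4 := by
  have h := two_pow_eta_mul_le m
  have h2 := (eta_spec m).1
  have : 2 ^ eta m * 2 ≤ 2 ^ eta m * eta m := Nat.mul_le_mul_left _ h2
  omega

/-- `N₁ ≤ 17 (m + 2)`. [folklore] -/
theorem N1_le (m : ℕ) : N1 m ≤ 17 * (m + 2) := by
  unfold N1 lenOf kOf
  rw [MOf_succ]
  have h1 := two_pow_eta_mul_le m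
  have h2 := two_pow_eta_le m
  have h3 : eta m ≤ 2 ^ eta m := Nat.lt_two_pow_self.le
  have e : 2 ^ eta m * (2 * eta m + 2) = 2 * (2 ^ eta m * eta m) + 2 * 2 ^ eta m := by ring
  rw [e]
  omega

/-- `A = 4^{η+1} ≤ 16 (m + 2)²`. [folklore] -/
theorem AOf_eta_le (m : ℕ) : AOf (eta m) ≤ 16 * (m + 2) ^ 2 := by
  have h := two_pow_eta_le m
  unfold AOf
  have e : (4 : ℕ) ^ (eta m + 1) = 4 * (2 ^ eta m) ^ 2 := by
    rw [pow_succ, mul_comm]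
    congr 1
    rw [← pow_mul, mul_comm, pow_mul]; norm_num
  rw [e]
  nlinarith [Nat.pow_le_pow_left h 2]

/-- `2^ℓ ≤ 2n + 2`. [folklore] -/
theorem two_pow_ell_le (n : ℕ) : 2 ^ ell n ≤ 2 * n + 2 := by
  unfold ell
  rw [pow_succ]
  rcases Nat.eq_zero_or_pos n with rfl | hn
  · simp
  · have := Nat.pow_log_le_self 2 hn.ne'
    omega

/-- `S₂ ≤ 12 (n + 2)³`. [folklore] -/
theorem S2_le (n : ℕ) : S2 n ≤ 12 * (n + 2) ^ 3 := by
  unfold S2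
  have hu : univBound (ell n) ≤ 10 * n + 10 := by
    have := Literature.Computability.AlgebraicComplexity.RazMonomialCkt.univBound_le (ell n); have := two_pow_ell_le n; omega
  have h1 : n * univBound (ell n) + n + 2 ≤ 12 * (n + 2) ^ 2 := by nlinarith
  calc n * (n * univBound (ell n) + n + 2) ≤ (n + 2) * (12 * (n + 2) ^ 2) :=
        Nat.mul_le_mul (by omega) h1
    _ = 12 * (n + 2) ^ 3 := by ring

/-- The constant of `k`: `κ = 72 · 17⁶`. [folklore] -/
def κ : ℕ := 72 * 17 ^ 6

/-- The constant of `C`: `γ = 24 · 17⁶ κ`. [folklore] -/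
def γ : ℕ := 24 * 17 ^ 6 * κ

/-- `1 ≤ κ`. [folklore] -/
theorem one_le_κ : 1 ≤ κ := by unfold κ; norm_num

/-- `2400 ≤ κ`. [folklore] -/
theorem κ_large : 2400 ≤ κ := by unfold κ; norm_num

/-- `1 ≤ γ`. [folklore] -/
theorem one_le_γ : 1 ≤ γ := by unfold γ κ; norm_num

/-- `13 ≤ γ² κ²`. [folklore] -/
theorem γκ_large : 13 ≤ γ ^ 2 * κ ^ 2 := by
  have h1 : 1 ≤ γ ^ 2 := Nat.one_le_pow _ _ one_le_γ
  have h2 : 2400 ^ 2 ≤ κ ^ 2 := Nat.pow_le_pow_left κ_large 2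
  calc 13 ≤ 1 * 2400 ^ 2 := by norm_num
    _ ≤ γ ^ 2 * κ ^ 2 := Nat.mul_le_mul h1 h2

/-- `κ = 72 · 17⁶` as an equation (for `ring` after `unfold`). [folklore] -/
theorem κ_def : κ = 72 * 17 ^ 6 := rfl

/-- `γ = 24 · 17⁶ κ`. [folklore] -/
theorem γ_def : γ = 24 * 17 ^ 6 * κ := rfl

attribute [irreducible] κ γ

variable (m n : ℕ)

/-- The common yardstick `T = n + m + 2`. [folklore] -/
abbrev T : ℕ := n + m + 2

/-- `k ≤ κ T⁹`. [folklore] -/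
theorem kk_le : kk m n ≤ κ * T m n ^ 9 := by
  have hS := S2_le n
  have hN := N1_le m
  have hn2 : n + 2 ≤ T m n := by unfold T; omega
  have hm2 : m + 2 ≤ T m n := by unfold T; omega
  unfold kk
  rw [κ_def]
  calc 6 * S2 n * N1 m ^ 6 ≤ 6 * (12 * (n + 2) ^ 3) * (17 * (m + 2)) ^ 6 := by gcongr
    _ ≤ 6 * (12 * T m n ^ 3) * (17 * T m n) ^ 6 := by gcongr
    _ = 72 * 17 ^ 6 * T m n ^ 9 := by ring

/-- `C ≤ γ T¹⁸`. [folklore] -/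
theorem CC_le : CC m n ≤ γ * T m n ^ 18 := by
  have hk := kk_le m n
  have hS := S2_le n
  have hN := N1_le m
  have hn2 : n + 2 ≤ T m n := by unfold T; omega
  have hm2 : m + 2 ≤ T m n := by unfold T; omega
  unfold CC
  rw [γ_def]
  calc 2 * kk m n * S2 n * N1 m ^ 6 ≤ 2 * (κ * T m n ^ 9) * (12 * (n + 2) ^ 3) * (17 * (m + 2)) ^ 6 := by gcongr
    _ ≤ 2 * (κ * T m n ^ 9) * (12 * T m n ^ 3) * (17 * T m n) ^ 6 := by gcongr
    _ = 24 * 17 ^ 6 * κ * T m n ^ 18 := by ring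

/-- `2^{mH} ≤ 2k + 2`. [folklore] -/
theorem two_pow_mH_le : 2 ^ mH m n ≤ 2 * kk m n + 2 := by
  unfold mH
  rw [pow_succ]
  rcases Nat.eq_zero_or_pos (kk m n) with h0 | hk
  · rw [h0]; simp
  · have := Nat.pow_log_le_self 2 hk.ne'; omega

/-- `predSize q₁² k S₂ mH ≤ 25 κ² T¹⁸`. [folklore] -/
theorem predSize_le : predSize (q1 m * q1 m) (kk m n) (S2 n) (mH m n) ≤ 25 * κ ^ 2 * T m n ^ 18 := by
  have hk := kk_le m n
  have hS := S2_le n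
  have hq : q1 m ≤ 34 * T m n := by have := (q1_spec m).2.2; have := N1_le m; unfold T; omega
  have hn2 : n + 2 ≤ T m n := by unfold T; omega
  have ht2 : 2 ≤ T m n := by unfold T; omega
  have hub : univBound (mH m n) ≤ 10 * kk m n + 10 := by
    have := Literature.Computability.AlgebraicComplexity.RazMonomialCkt.univBound_le (mH m n); have := two_pow_mH_le m n; omega
  have hκ := κ_large
  generalize T m n = t at hk hq hn2 ht2 ⊢
  have ht1 : 1 ≤ t := by omega
  -- atoms: `A = κ² t¹⁸`, `B = κ t¹⁸`
  obtain ⟨A, hA⟩ : ∃ A, A = κ ^ 2 * t ^ 18 := ⟨_, rfl⟩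
  obtain ⟨B, hB⟩ : ∃ B, B = κ * t ^ 18 := ⟨_, rfl⟩
  have hAB : A = κ * B := by rw [hA, hB, pow_two, mul_assoc]
  have h18 : 1 ≤ t ^ 18 := Nat.one_le_pow _ _ ht1
  have hB1 : κ ≤ B := by rw [hB]; exact Nat.le_mul_of_pos_right _ h18
  have hp2 : t ^ 2 ≤ t ^ 18 := Nat.pow_le_pow_right ht1 (by norm_num)
  have hp3 : t ^ 3 ≤ t ^ 18 := Nat.pow_le_pow_right ht1 (by norm_num)
  have hp9 : t ^ 9 ≤ t ^ 18 := Nat.pow_le_pow_right ht1 (by norm_num)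
  -- the pieces
  have hd : q1 m * q1 m ≤ B := by
    calc q1 m * q1 m ≤ (34 * t) * (34 * t) := Nat.mul_le_mul hq hq
      _ = 1156 * t ^ 2 := by ring
      _ ≤ κ * t ^ 18 := Nat.mul_le_mul (by omega) hp2
      _ = B := hB.symm
  have hS' : S2 n + 2 ≤ B := by
    have h1 : S2 n ≤ 12 * t ^ 3 := hS.trans (Nat.mul_le_mul_left _ (Nat.pow_le_pow_left hn2 3))
    have h2 : 12 * t ^ 3 + 2 ≤ 14 * t ^ 18 := by omega
    calc S2 n + 2 ≤ 14 * t ^ 18 := by omega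
      _ ≤ κ * t ^ 18 := Nat.mul_le_mul_right _ (by omega)
      _ = B := hB.symm
  have hk' : kk m n + 1 ≤ B := by
    have h1 : 2 * t ^ 9 ≤ t ^ 18 := by
      calc 2 * t ^ 9 ≤ t * t ^ 9 := Nat.mul_le_mul_right _ ht2
        _ = t ^ 10 := by ring
        _ ≤ t ^ 18 := Nat.pow_le_pow_right ht1 (by norm_num)
    have h2 : 1 ≤ κ * t ^ 9 := Nat.mul_le_mul one_le_κ (Nat.one_le_pow _ _ ht1)
    calc kk m n + 1 ≤ κ * t ^ 9 + κ * t ^ 9 := Nat.add_le_add hk h2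
      _ = κ * (2 * t ^ 9) := by ring
      _ ≤ κ * t ^ 18 := Nat.mul_le_mul_left _ h1
      _ = B := hB.symm
  have hsmall : 26 * B + 3 ≤ A := by
    have hB1' : 1 ≤ B := le_trans (by omega) hB1
    rw [hAB]
    have := Nat.mul_le_mul_right B (show 29 ≤ κ by omega)
    omega
  have hkub : kk m n * univBound (mH m n) ≤ 10 * A + 10 * B := by
    have h9 : κ * t ^ 9 ≤ B := by rw [hB]; exact Nat.mul_le_mul_left _ hp9
    calc kk m n * univBound (mH m n) ≤ (κ * t ^ 9) * (10 * (κ * t ^ 9) + 10) :=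
          Nat.mul_le_mul hk (hub.trans (by omega))
      _ = 10 * (κ ^ 2 * (t ^ 9 * t ^ 9)) + 10 * (κ * t ^ 9) := by ring
      _ = 10 * A + 10 * (κ * t ^ 9) := by rw [hA, ← pow_add]
      _ ≤ 10 * A + 10 * B := by omega
  have hu : 25 * κ ^ 2 * t ^ 18 = 25 * A := by rw [hA]; ring
  rw [hu]
  unfold predSize
  omega

/-- `sBig ≤ 76 γ² κ² T⁵⁴`. [folklore] -/
theorem sBig_le : sBig m n ≤ 76 * γ ^ 2 * κ ^ 2 * T m n ^ 54 := by
  have hP := predSize_le m n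
  have hC := CC_le m n
  have ht2 : 2 ≤ T m n := by unfold T; omega
  generalize T m n = t at hP hC ht2 ⊢
  have ht1 : 1 ≤ t := by omega
  -- atoms: `G = γ² t³⁶`, `W = γ² κ² t⁵⁴`
  obtain ⟨G, hG⟩ : ∃ G, G = γ ^ 2 * t ^ 36 := ⟨_, rfl⟩
  obtain ⟨W, hW⟩ : ∃ W, W = γ ^ 2 * κ ^ 2 * t ^ 54 := ⟨_, rfl⟩
  have hC2 : CC m n ^ 2 ≤ G := by
    calc CC m n ^ 2 ≤ (γ * t ^ 18) ^ 2 := Nat.pow_le_pow_left hC 2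
      _ = γ ^ 2 * t ^ 36 := by ring
      _ = G := hG.symm
  have hGW : 12 * G ≤ W := by
    have hκ2 : 12 ≤ κ ^ 2 := le_trans (by norm_num) (Nat.pow_le_pow_left κ_large 2)
    have h54 : t ^ 36 ≤ t ^ 54 := Nat.pow_le_pow_right ht1 (by norm_num)
    calc 12 * G = 12 * (γ ^ 2 * t ^ 36) := by rw [hG]
      _ ≤ κ ^ 2 * (γ ^ 2 * t ^ 54) := Nat.mul_le_mul hκ2 (Nat.mul_le_mul_left _ h54)
      _ = W := by rw [hW]; ring
  have hGP : G * (25 * κ ^ 2 * t ^ 18) = 25 * W := by rw [hG, hW]; ring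
  have hG1 : 1 ≤ G := by
    rw [hG]; exact Nat.mul_le_mul (Nat.one_le_pow _ _ one_le_γ) (Nat.one_le_pow _ _ ht1)
  have hj : 76 * γ ^ 2 * κ ^ 2 * t ^ 54 = 76 * W := by rw [hW]; ring
  rw [hj]
  have hmain : (2 * CC m n ^ 2 + 1) * predSize (q1 m * q1 m) (kk m n) (S2 n) (mH m n) ≤ 75 * W := by
    calc (2 * CC m n ^ 2 + 1) * predSize (q1 m * q1 m) (kk m n) (S2 n) (mH m n)
        ≤ (3 * G) * (25 * κ ^ 2 * t ^ 18) := Nat.mul_le_mul (by omega) hP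
      _ = 3 * (G * (25 * κ ^ 2 * t ^ 18)) := by ring
      _ = 75 * W := by rw [hGP]; ring
  unfold sBig
  omega

/-- The constant of the size bound: `Z = 432 · 16⁶ · 78 γ² κ²`. [folklore] -/
def Z : ℕ := 432 * 16 ^ 6 * 78 * γ ^ 2 * κ ^ 2

/-- **The size bound is polynomial**: `sizeBound m n ≤ Z · T⁶⁶`. [folklore] -/
theorem sizeBound_le : sizeBound m n ≤ Z * T m n ^ 66 := by
  have hs := sBig_le m n
  have hA := AOf_eta_le m
  have hm2 : m + 2 ≤ T m n := by unfold T; omega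
  generalize T m n = t at hs hm2 ⊢
  have ht1 : 1 ≤ t := by omega
  obtain ⟨W, hW⟩ : ∃ W, W = γ ^ 2 * κ ^ 2 * t ^ 54 := ⟨_, rfl⟩
  obtain ⟨V, hV⟩ : ∃ V, V = γ ^ 2 * κ ^ 2 * t ^ 66 := ⟨_, rfl⟩
  have hA' : AOf (eta m) ≤ 16 * t ^ 2 := hA.trans (Nat.mul_le_mul_left _ (Nat.pow_le_pow_left hm2 2))
  have hA6 : AOf (eta m) ^ 6 ≤ 16 ^ 6 * t ^ 12 := by
    calc AOf (eta m) ^ 6 ≤ (16 * t ^ 2) ^ 6 := Nat.pow_le_pow_left hA' 6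
      _ = 16 ^ 6 * t ^ 12 := by ring
  have hWV : t ^ 12 * W = V := by rw [hW, hV]; ring
  have hV1 : 2 ≤ V := by
    rw [hV]; exact le_trans (by norm_num) (Nat.mul_le_mul γκ_large (Nat.one_le_pow _ _ ht1))
  have e76 : 76 * γ ^ 2 * κ ^ 2 * t ^ 54 = 76 * W := by rw [hW]; ring
  rw [e76] at hs
  have h1 : sBig m n + 11 ≤ 77 * W := by
    have : 11 ≤ W := by rw [hW]; exact le_trans (by norm_num) (Nat.mul_le_mul γκ_large (Nat.one_le_pow _ _ ht1))
    omega
  have hmain : 432 * AOf (eta m) ^ 6 * (sBig m n + 11) ≤ 432 * 16 ^ 6 * 77 * V := by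
    calc 432 * AOf (eta m) ^ 6 * (sBig m n + 11) ≤ 432 * (16 ^ 6 * t ^ 12) * (77 * W) :=
          Nat.mul_le_mul (Nat.mul_le_mul_left _ hA6) h1
      _ = 432 * 16 ^ 6 * 77 * (t ^ 12 * W) := by ring
      _ = 432 * 16 ^ 6 * 77 * V := by rw [hWV]
  have hZ : Z * t ^ 66 = 432 * 16 ^ 6 * 78 * V := by rw [hV]; unfold Z; ring
  rw [hZ]
  unfold sizeBound
  omega

attribute [irreducible] Z

end Bounds

/-! ### The seed is `O(m⁴)` in the non-vacuous regime -/

section Seed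

variable (m n : ℕ)

/-- Every function on `m` variables has circuit complexity `≤ univBound m`. [cite: AroraBarakCC2009, Claim 2.13] -/
theorem circuitSizeOver_le_univBound {m : ℕ} (f : (Fin m → Bool) → Bool) : circuitSizeOver B2 f ≤ univBound m := by
  obtain ⟨K, hB, hs, he⟩ := (cktSize_univ fun (v : Fin m → Bool) (_ : Unit) => f v).toCircuit
  exact (circuitSizeOver_le_of_computes K hB he).trans (by simpa using hs)

/-- **The non-vacuous regime is `T < 2^{m+3}`**: if `(n + m)^{c₀} < circuitSizeOver B2 f` for some `c₀ ≥ 1`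
then `n + m < 5 · 2^m`. [folklore] -/
theorem T_lt_two_pow {m n c₀ : ℕ} (hc : 1 ≤ c₀) {f : (Fin m → Bool) → Bool}
    (h : (n + m) ^ c₀ < circuitSizeOver B2 f) : T m n < 2 ^ (m + 3) := by
  have h1 : n + m ≤ (n + m) ^ c₀ := by
    rcases Nat.eq_zero_or_pos (n + m) with h0 | hp
    · rw [h0]; exact Nat.zero_le _
    · calc n + m = (n + m) ^ 1 := (pow_one _).symm
        _ ≤ (n + m) ^ c₀ := Nat.pow_le_pow_right hp hc
  have h2 := circuitSizeOver_le_univBound f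
  have h3 := Literature.Computability.AlgebraicComplexity.RazMonomialCkt.univBound_le m
  unfold T
  rw [pow_add]
  omega

/-- `κ < 2³¹`. [folklore] -/
theorem κ_lt : κ < 2 ^ 31 := by rw [κ_def]; norm_num

/-- `mH ≤ 9m + 59` in the non-vacuous regime. [folklore] -/
theorem mH_le (hT : T m n < 2 ^ (m + 3)) : mH m n ≤ 9 * m + 59 := by
  have hk := kk_le m n
  have h9 : T m n ^ 9 < 2 ^ (9 * (m + 3)) := by
    calc T m n ^ 9 < (2 ^ (m + 3)) ^ 9 := Nat.pow_lt_pow_left hT (by norm_num)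
      _ = 2 ^ (9 * (m + 3)) := by rw [← pow_mul, mul_comm]
  have hlt : kk m n < 2 ^ (9 * m + 58) := by
    have e : 2 ^ (9 * m + 58) = 2 ^ 31 * 2 ^ (9 * (m + 3)) := by rw [← pow_add]; congr 1; ring
    rw [e]
    calc kk m n ≤ κ * T m n ^ 9 := hk
      _ < 2 ^ 31 * 2 ^ (9 * (m + 3)) := Nat.mul_lt_mul'' κ_lt h9
  unfold mH
  have hlog : Nat.log 2 (kk m n) < 9 * m + 58 := by
    rcases Nat.eq_zero_or_pos (kk m n) with h0 | hpos
    · rw [h0, Nat.log_zero_right]; omega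
    · exact Nat.log_lt_of_lt_pow hpos.ne' hlt
  omega

/-- `L₂ ≤ 1200 (m + 2)²` in the non-vacuous regime. [folklore] -/
theorem L2_le (hT : T m n < 2 ^ (m + 3)) : L2 m n ≤ 1200 * (m + 2) ^ 2 := by
  have hN := N1_le m
  have hq : q1 m ≤ 34 * (m + 2) := by have := (q1_spec m).2.2; omega
  have hH := mH_le m n hT
  unfold L2
  nlinarith

/-- `seedLen ≤ 2400² (m + 2)⁴` in the non-vacuous regime. [folklore] -/
theorem seedLen_le (hT : T m n < 2 ^ (m + 3)) : seedLen m n ≤ 2400 ^ 2 * (m + 2) ^ 4 := by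
  have hL := L2_le m n hT
  have hq : q2 m n ≤ 2 * L2 m n := (q2_spec m n).2.2
  unfold seedLen
  calc q2 m n * q2 m n ≤ (2 * (1200 * (m + 2) ^ 2)) * (2 * (1200 * (m + 2) ^ 2)) :=
        Nat.mul_le_mul (hq.trans (by omega)) (hq.trans (by omega))
    _ = 2400 ^ 2 * (m + 2) ^ 4 := by ring

/-- The seed constant: `2400² · 81` (so that `seedLen ≤ cSeed · m⁴` for `m ≥ 1`). [folklore] -/
def cSeed : ℕ := 2400 ^ 2 * 81

/-- **The seed is at most `cSeed · m⁴`** for `m ≥ 1` in the non-vacuous regime. [cite: ImpagliazzoKabanetsWigderson2002, Thm. 11] -/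
theorem seedLen_le_mul_pow (hm : 1 ≤ m) (hT : T m n < 2 ^ (m + 3)) : seedLen m n ≤ cSeed * m ^ 4 := by
  have h := seedLen_le m n hT
  have h4 : (m + 2) ^ 4 ≤ 81 * m ^ 4 := by
    calc (m + 2) ^ 4 ≤ (3 * m) ^ 4 := Nat.pow_le_pow_left (by omega) 4
      _ = 81 * m ^ 4 := by ring
  unfold cSeed
  calc seedLen m n ≤ 2400 ^ 2 * (m + 2) ^ 4 := h
    _ ≤ 2400 ^ 2 * (81 * m ^ 4) := Nat.mul_le_mul_left _ h4
    _ = 2400 ^ 2 * 81 * m ^ 4 := by ring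

end Seed

/-! ### The generator on a fixed number of seed bits, and the main theorem -/

section Main

variable {m : ℕ} (f : (Fin m → Bool) → Bool) (n : ℕ)

open Classical in
/-- **The generator on `K` seed bits**: the first `q₂²` of them feed `gen`; if `K` is too small (only in
the vacuous regime) the output is constant. [cite: ImpagliazzoKabanetsWigderson2002, Thm. 11] -/
def genPad (K : ℕ) (s : Fin K → Bool) : Fin n → Bool :=
  if h : seedLen m n ≤ K then gen f n (fun p => s (Fin.castLE h p)) else fun _ => false

/-- Extra seed bits do not change the distinguishing advantage: `genPad` is `SIZE(n)`-pseudorandom when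
`gen` is. [folklore] -/
theorem isSizePseudorandom_genPad {K : ℕ} (hK : seedLen m n ≤ K) (h : IsSizePseudorandom (gen f n)) :
    IsSizePseudorandom (genPad f n K) := by
  classical
  intro C hB hs
  have hadv := h C hB hs
  unfold prgAdvantage at hadv ⊢
  have hgp : ∀ s : Fin K → Bool, genPad f n K s = gen f n fun p => s (Fin.castLE hK p) := fun s => by
    unfold genPad; rw [dif_pos hK]
  simp only [hgp]
  have hc := card_filter_castLE hK (fun s' : Fin (seedLen m n) → Bool => C.eval (gen f n s') = true)
    (inst₁ := fun _ => inferInstance) (inst₂ := fun _ => inferInstance)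
  have e : ((Finset.univ.filter fun s : Fin K → Bool =>
      C.eval (gen f n fun p => s (Fin.castLE hK p)) = true).card : ℝ) / 2 ^ K =
      ((Finset.univ.filter fun s' : Fin (seedLen m n) → Bool => C.eval (gen f n s') = true).card : ℝ) /
        2 ^ seedLen m n := by
    rw [hc, Nat.cast_mul, Nat.cast_pow, Nat.cast_ofNat]
    rw [show (2 : ℝ) ^ K = 2 ^ (K - seedLen m n) * 2 ^ seedLen m n by
      rw [← pow_add, Nat.sub_add_cancel hK]]
    field_simp
  rw [e]
  exact hadv

/-- At output length `0` every generator is `SIZE(0)`-pseudorandom (there is no circuit of size `0` on no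
inputs). [folklore] -/
theorem isSizePseudorandom_zero {K : ℕ} (g : (Fin K → Bool) → (Fin 0 → Bool)) : IsSizePseudorandom g := by
  intro C _ hs
  exfalso
  have hg : C.gates = [] := List.eq_nil_of_length_eq_zero (Nat.le_zero.1 hs)
  rcases h : C.output with i | k
  · exact i.elim0
  · have := C.wf_output k h
    rw [hg] at this
    exact Nat.not_lt_zero _ this

/-- **The pseudorandom generator armed with a hard truth table — the combinatorial statement of IKW's
Theorem 11 with seed `c · m⁴`**: there is `c₀` such that for all `m, n` and every `f : {0,1}^m → {0,1}` with
`circuitSizeOver B2 f > (n + m)^{c₀}`, the generator `genPad f n (c₀ · m⁴) : {0,1}^{c₀ m⁴} → {0,1}ⁿ` is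
`SIZE(n)`-pseudorandom. (The `FP` machine computing it from the table `tt f`, the seed and `1ⁿ` — the other
half of the discrete Theorem 11 — is separate.) [cite: ImpagliazzoKabanetsWigderson2002, Thm. 11] -/
theorem exists_hardness_exponent :
    ∃ c₀ : ℕ, 1 ≤ c₀ ∧ ∀ (m n : ℕ) (f : (Fin m → Bool) → Bool),
      (n + m) ^ c₀ < circuitSizeOver B2 f → IsSizePseudorandom (genPad f n (c₀ * m ^ 4)) := by
  refine ⟨max cSeed (2 * (66 + Z) + 1), le_max_of_le_right (by omega), fun m n f hf => ?_⟩
  set c₀ := max cSeed (2 * (66 + Z) + 1) with hc₀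
  have hc1 : 1 ≤ c₀ := le_max_of_le_right (by omega)
  -- `n = 0`: vacuous
  rcases Nat.eq_zero_or_pos n with hn0 | hn
  · subst hn0; exact isSizePseudorandom_zero _
  -- `m = 0`: the hypothesis fails (`cso f ≤ 1`)
  rcases Nat.eq_zero_or_pos m with hm0 | hm
  · exfalso
    subst hm0
    have h1 := circuitSizeOver_le_univBound f
    have h2 : 1 ≤ (n + 0) ^ c₀ := Nat.one_le_pow _ _ (by omega)
    simp only [univBound] at h1
    omega
  -- the regime and the seed
  have hT := T_lt_two_pow hc1 hf
  have hseed : seedLen m n ≤ c₀ * m ^ 4 :=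
    (seedLen_le_mul_pow m n hm hT).trans (Nat.mul_le_mul_right _ (le_max_left _ _))
  -- the size bound is below `(n + m)^{c₀}`
  have hT2 : 2 ≤ T m n := by unfold T; omega
  have hZ : Z ≤ T m n ^ Z := (Nat.lt_two_pow_self).le.trans (Nat.pow_le_pow_left hT2 Z)
  have hsb : sizeBound m n ≤ T m n ^ (66 + Z) := by
    calc sizeBound m n ≤ Z * T m n ^ 66 := sizeBound_le m n
      _ ≤ T m n ^ Z * T m n ^ 66 := Nat.mul_le_mul_right _ hZ
      _ = T m n ^ (66 + Z) := by rw [← pow_add, add_comm]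
  have hTsq : T m n ≤ (n + m) ^ 2 := by unfold T; nlinarith
  have hsize : sizeBound m n < circuitSizeOver B2 f := by
    calc sizeBound m n ≤ T m n ^ (66 + Z) := hsb
      _ ≤ ((n + m) ^ 2) ^ (66 + Z) := Nat.pow_le_pow_left hTsq _
      _ = (n + m) ^ (2 * (66 + Z)) := by rw [← pow_mul]
      _ ≤ (n + m) ^ c₀ := Nat.pow_le_pow_right (by omega) ((Nat.le_succ _).trans (le_max_right _ _))
      _ < circuitSizeOver B2 f := hf
  exact isSizePseudorandom_genPad f n hseed (isSizePseudorandom_gen f n hn hsize)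

end Main

end IKWGen

end Literature.Computability.Complexity

end
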